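import Literature.AlgebraicGeometry.Frobenioids.ArithmeticFrobenioidThm64iiAtData
import Literature.AlgebraicGeometry.Frobenioids.Cor54SubBiratCompatProofs
import Literature.AlgebraicGeometry.Frobenioids.Cor54SubRealSpanCompatProofs
import Literature.AlgebraicGeometry.Frobenioids.Prop53SubProofs
import Literature.AlgebraicGeometry.Frobenioids.EquivalencePreStepsQuasiIsotropic
import Literature.AlgebraicGeometry.Frobenioids.BaseSectionsOfObjectsCor57NonVacuity
import Literature.AlgebraicGeometry.Frobenioids.PerfectionDivisorial
import Literature.AlgebraicGeometry.Frobenioids.ArithmeticDivisorsMonoidIsoPlaces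
import Literature.AlgebraicGeometry.Frobenioids.ArithmeticFrobenioidThm64iii
import HarnessLib

/-!
# Frobenioids I, Theorem 6.4 (ii)–(iv) at the arithmetic Frobenioids `C_{K/F}`: the DEGREE of the divisor
# transport `Ψ^Φ` — the `Φ ⊆ Φ^rlf` adapter (row «T64/θ↔rlf ADAPTER»)

Mochizuki, *The geometry of Frobenioids I*, Kyushu J. Math. **62** (2008): Thm. 6.4 (ii) p. 114 and its proof
p. 115 l. 34 – p. 116 l. 2 ("the isomorphism of groups `Pic_Φ(A₁) ⥲ Pic_Φ(A₂)` determined by `Ψ^rlf` … arises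
from an isomorphism of monoids `Φ₁^rlf(A₁) ⥲ Φ₂^rlf(A₂)`"), Thm. 6.4 (iii)/(iv) p. 115 ("`deg^arith_{L_i}` maps a
generator of the monoid `Φ_i(L_i)_{v_i}` … to `log(p)`", p. 116), Cor. 5.4 p. 104 [cite: MochizukiFrdI2008, Thm. 6.4 (ii) p.114]
[cite: MochizukiFrdI2008, Cor. 5.4 p.104].

PROOF-ONLY companion (abc-iut-L1-d1 gen 3; L1-lead R122 (4) GO «T64/θ↔rlf ADAPTER»). In the cell's assembly of
Thm. 6.4 at THE data, the Φ-LEVEL transport `Ψ^Φ : Φ₁ ⥲ Φ₂` of an equivalence `Ψ : C_{K₁/F₁} ⥲ C_{K₂/F₂}` (Cor. 4.11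
(iii)/(iv); this seat's `ArithmeticFrobenioidDivisorTransport.lean`, abc-iut-L1-d7's `ArithmeticFrobenioidThm64ivTransport.lean`)
and the Φ^rlf-LEVEL transport of the realifications (abc-iut-w4-d086's `ArithRlfPic.exists_pic_transport_deg`, which
produces THE `Pic` transport and ONE degree `deg(Ψ^rlf) > 0`) must be COMPARED along `ι : Φ ⊆ Φ^rlf`. This file
does it, over the Cor. 4.11 (iv) datum of `Ψ` as BINDERS (`Ψ^Base` an equivalence, `E = Ψ^Φ`, `η`, the Div clause —
exactly the components delivered binder-free by `exists_divisorTransport_arith`):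

* `arith_biratCompat_of_datum` — `Ψ^Φ` carries `Φ₁^birat` onto `Φ₂^birat` (Cor. 5.4's input from Cor. 4.10;
  abc-iut-w5-d221's `FrdI.Cor54Sub.biratCompat_of`, its Thm. 3.4 (ii) inputs discharged over the FSM-type base by
  abc-iut-L1-t13's `FrdI.thm34ii_of_isOfFSMType`);
* `arith_realSpanCompat_of_datum` — hence the REALIFIED transport `(Ψ^Φ)^rlf` (abc-iut-w5-d137's
  `FrdI.Cor54Sub.rlfIso`, lying over `Ψ^Φ` along `ι`: `rlfIso_toRlf`) carries `ℝ·Φ₁^birat` onto `ℝ·Φ₂^birat`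
  (abc-iut-w5-d097's `realSpanCompat_holds`) — the binder `hspan` of abc-iut-w4-d086's Thm. 6.4 (ii) at the data;
* `exists_deg_divisorTransport_of_datum` — **THE DEGREE CLAUSE**: there is ONE `deg > 0` with
  `deg^arith(Ψ^Φ_L D) = deg · deg^arith(D)` for every `Spec L ∈ Ob(D₁)` and every effective arithmetic divisor
  `D` on `L` (Thm. 6.4 (ii) read through `ι`, by abc-iut-L1-d2's `ArithRlfPic.picDegree_mk_iota`);
* `perfectedTransport_degree_of_datum` — **the binder `hθd` of abc-iut-L1-d9's `thm64iii_of_mulEquiv`** for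
  `θ_L := (Ψ^Φ_L)^pf` (`Perfection.congr`) and ANY pair of degree extensions `d_i : Φ_i(L_i)^pf → ℝ` of `deg^arith`:
  `d₂ (θ x) = deg · d₁ x`;
* `logNorm_transport_of_datum` — **the binder `hgen` of abc-iut-L1-t3's `Thm64iv_of_logNorm_transport_schema`**:
  along the finite-place bijections `π_L` with `Ψ^Φ_L(δ_w) = δ_{π_L w}` ("generator ↦ generator"),
  `log N(π_L w) = deg · log N(w)`.

No definitions, no named facts; nothing here bears on, or takes a side on, [IUTchIII] Cor. 3.12.
-/

noncomputable section

open scoped NNReal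

namespace Literature.AlgebraicGeometry.Frobenioids

open CategoryTheory Opposite NumberField
open Literature.AnabelianGeometry.EtaleTheta
open PreFrobenioid

section Arith

variable {F₁ : Type} [Field F₁] [NumberField F₁] {K₁ : Type} [Field K₁] [Algebra F₁ K₁] [IsGalois F₁ K₁]
variable {F₂ : Type} [Field F₂] [NumberField F₂] {K₂ : Type} [Field K₂] [Algebra F₂ K₂] [IsGalois F₂ K₂]
variable (Ψ : arithFrobenioid F₁ K₁ ≌ arithFrobenioid F₂ K₂)
  (ΨBase : FinSubextCat F₁ K₁ ⥤ FinSubextCat F₂ K₂) [ΨBase.IsEquivalence]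
  (E : (arithFrobenioidOps F₁ K₁).DivisorMonoidIsoOverBase (arithFrobenioidOps F₂ K₂) ΨBase)
  (η : Ψ.functor ⋙ (arithFrobenioidOps F₂ K₂).base ≅ (arithFrobenioidOps F₁ K₁).base ⋙ ΨBase)
  (hdiv : ∀ ⦃A B : arithFrobenioid F₁ K₁⦄ (φ : A ⟶ B),
    (arithFrobenioidOps F₂ K₂).div (Ψ.functor.map φ) =
      (arithFrobenioidOps F₂ K₂).pull (η.hom.app A)
        (E.iso ((arithFrobenioidOps F₁ K₁).base.obj A) ((arithFrobenioidOps F₁ K₁).div φ)))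

/-! ### `Ψ^Φ` carries `Φ^birat` and `ℝ · Φ^birat` -/

include η hdiv in
/-- **`Ψ^Φ` carries `Φ₁^birat(L)` ONTO `Φ₂^birat(Ψ^Base L)`** (Cor. 5.4 "follows immediately from Corollaries 4.10;
4.11, (iii), (iv)", p. 104 — the `Φ^birat` part; abc-iut-w5-d221's `FrdI.Cor54Sub.biratCompat_of`), for the Cor. 4.11
(iv) datum `(Ψ^Base, Ψ^Φ, η, Div)` of an equivalence of arithmetic Frobenioids: the remaining inputs — `Ψ`, `Ψ⁻¹`
preserve pre-steps and co-angular pre-steps — are [FrdI] Thm. 3.4 (ii) over the FSM-type base `B(Gal(K/F))⁰`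
(abc-iut-L1-t13 lineage `FrdI.thm34ii_of_isOfFSMType`; quasi-isotropy from Thm. 6.4 (i) "standard type").
[cite: MochizukiFrdI2008, Cor. 5.4 p.104] -/
theorem arith_biratCompat_of_datum :
    FrdI.Cor54Sub.BiratCompat
      (ModelFrobenioid.toElem (arithDivisorFunctor F₁ K₁) (unitsFunctor F₁ K₁) (divNatTrans F₁ K₁))
      (ModelFrobenioid.toElem (arithDivisorFunctor F₂ K₂) (unitsFunctor F₂ K₂) (divNatTrans F₂ K₂)) ΨBase E := by
  have h12 := FrdI.thm34ii_of_isOfFSMType (arithFrobenioid_isFrobenioid F₁ K₁) (arithFrobenioid_isFrobenioid F₂ K₂)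
    (isOfStandardType_arith F₁ K₁).quasiIsotropic (isOfStandardType_arith F₂ K₂).quasiIsotropic
    (FinSubextCat.isOfFSMType F₁ K₁) (FinSubextCat.isOfFSMType F₂ K₂) Ψ
  have h21 := FrdI.thm34ii_of_isOfFSMType (arithFrobenioid_isFrobenioid F₂ K₂) (arithFrobenioid_isFrobenioid F₁ K₁)
    (isOfStandardType_arith F₂ K₂).quasiIsotropic (isOfStandardType_arith F₁ K₁).quasiIsotropic
    (FinSubextCat.isOfFSMType F₂ K₂) (FinSubextCat.isOfFSMType F₁ K₁) Ψ.symm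
  exact FrdI.Cor54Sub.biratCompat_of
    (ModelFrobenioid.toElem (arithDivisorFunctor F₁ K₁) (unitsFunctor F₁ K₁) (divNatTrans F₁ K₁))
    (ModelFrobenioid.toElem (arithDivisorFunctor F₂ K₂) (unitsFunctor F₂ K₂) (divNatTrans F₂ K₂))
    Ψ (arithFrobenioid_isFrobenioid F₂ K₂).isPreFrobenioid ΨBase E η hdiv h12.1 h12.2.1 h21.1 h21.2.1

include η hdiv in
/-- **The realified transport `(Ψ^Φ)^rlf` carries `ℝ·Φ₁^birat` ONTO `ℝ·Φ₂^birat`** (Cor. 5.4 p. 104; abc-iut-w5-d097's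
`FrdI.Cor54Sub.realSpanCompat_holds` fed with `arith_biratCompat_of_datum` and abc-iut-w5-d137's `rlfIso_toRlf`
"`(Ψ^Φ)^rlf ∘ ι = ι ∘ Ψ^Φ`") — the binder `hspan` of abc-iut-w4-d086's Thm. 6.4 (ii) at the data.
[cite: MochizukiFrdI2008, Cor. 5.4 p.104] -/
theorem arith_realSpanCompat_of_datum (X : FinSubextCat F₁ K₁) :
    (((RealificationData.canonical (arithDivisorFunctor F₁ K₁)
          (PreFrobenioid.IsPerfFactorialOn.op (arith_objectwise_isPerfFactorial F₁ K₁))).realSpan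
        (PreFrobenioid.biratSubfunctor (ModelFrobenioid.toElem (arithDivisorFunctor F₁ K₁) (unitsFunctor F₁ K₁)
          (divNatTrans F₁ K₁)))).carrier X).map
        (MonGp.map ((FrdI.Cor54Sub.rlfIso
          (ModelFrobenioid.toElem (arithDivisorFunctor F₁ K₁) (unitsFunctor F₁ K₁) (divNatTrans F₁ K₁))
          (arith_objectwise_isPerfFactorial F₁ K₁)
          (ModelFrobenioid.toElem (arithDivisorFunctor F₂ K₂) (unitsFunctor F₂ K₂) (divNatTrans F₂ K₂))
          (arith_objectwise_isPerfFactorial F₂ K₂) E).iso X).toMonoidHom) =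
      ((RealificationData.canonical (arithDivisorFunctor F₂ K₂)
          (PreFrobenioid.IsPerfFactorialOn.op (arith_objectwise_isPerfFactorial F₂ K₂))).realSpan
        (PreFrobenioid.biratSubfunctor (ModelFrobenioid.toElem (arithDivisorFunctor F₂ K₂) (unitsFunctor F₂ K₂)
          (divNatTrans F₂ K₂)))).carrier (ΨBase.obj X) :=
  FrdI.Cor54Sub.realSpanCompat_holds
    (ModelFrobenioid.toElem (arithDivisorFunctor F₁ K₁) (unitsFunctor F₁ K₁) (divNatTrans F₁ K₁)) (arith_objectwise_isPerfFactorial F₁ K₁)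
    (ModelFrobenioid.toElem (arithDivisorFunctor F₂ K₂) (unitsFunctor F₂ K₂) (divNatTrans F₂ K₂)) (arith_objectwise_isPerfFactorial F₂ K₂) E _
    (arith_biratCompat_of_datum Ψ ΨBase E η hdiv)
    (FrdI.Cor54Sub.rlfIso_toRlf
      (ModelFrobenioid.toElem (arithDivisorFunctor F₁ K₁) (unitsFunctor F₁ K₁) (divNatTrans F₁ K₁)) (arith_objectwise_isPerfFactorial F₁ K₁)
      (ModelFrobenioid.toElem (arithDivisorFunctor F₂ K₂) (unitsFunctor F₂ K₂) (divNatTrans F₂ K₂)) (arith_objectwise_isPerfFactorial F₂ K₂) E) X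

/-! ### The degree clause of `Ψ^Φ` -/

include η hdiv in
/-- **THE DEGREE CLAUSE of the divisor transport** (Thm. 6.4 (ii) read through `ι : Φ ⊆ Φ^rlf`): for the Cor. 4.11
(iv) datum of an equivalence `Ψ : C_{K₁/F₁} ⥲ C_{K₂/F₂}` there is ONE real number `deg > 0` — THE degree
`deg(Ψ^rlf)` of abc-iut-w4-d086's `ArithRlfPic.exists_pic_transport_deg` at the realified transport `(Ψ^Φ)^rlf` —
such that `deg^arith(Ψ^Φ_L D) = deg · deg^arith(D)` for every `Spec L ∈ Ob(D₁)` and every effective arithmetic divisor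
`D` on `L`: the `Pic` transport maps the class of `ι D` to the class of `(Ψ^Φ)^rlf(ι D) = ι(Ψ^Φ D)`, and `δ` reads
`deg^arith` on classes of `ι`'s (abc-iut-L1-d2's `ArithRlfPic.picDegree_mk_iota`).
[cite: MochizukiFrdI2008, Thm. 6.4 (ii) p.114] -/
theorem exists_deg_divisorTransport_of_datum :
    ∃ deg : ℝ, 0 < deg ∧
      ∀ (X : FinSubextCat F₁ K₁) (D : EffArithDivisor X.L),
        arithDegree (ΨBase.obj X).L
            (EffArithDivisor.toArithDivisor _ (Multiplicative.toAdd (E.iso X (Multiplicative.ofAdd D)))) =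
          deg * arithDegree X.L (EffArithDivisor.toArithDivisor _ D) := by
  have hΦ₁ := arith_objectwise_isPerfFactorial F₁ K₁
  have hΦ₂ := arith_objectwise_isPerfFactorial F₂ K₂
  -- the realified transport over the equivalence structure of `Ψ^Base`
  let Erlf : PreFrobenioidData.DivisorMonoidIsoOverBase
      (FrdI.Cor54Sub.rlfData (ModelFrobenioid.toElem (arithDivisorFunctor F₁ K₁) (unitsFunctor F₁ K₁)
        (divNatTrans F₁ K₁)) hΦ₁)
      (FrdI.Cor54Sub.rlfData (ModelFrobenioid.toElem (arithDivisorFunctor F₂ K₂) (unitsFunctor F₂ K₂)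
        (divNatTrans F₂ K₂)) hΦ₂) ΨBase.asEquivalence.functor :=
    FrdI.Cor54Sub.rlfIso
      (ModelFrobenioid.toElem (arithDivisorFunctor F₁ K₁) (unitsFunctor F₁ K₁) (divNatTrans F₁ K₁)) hΦ₁
      (ModelFrobenioid.toElem (arithDivisorFunctor F₂ K₂) (unitsFunctor F₂ K₂) (divNatTrans F₂ K₂)) hΦ₂ E
  obtain ⟨π, deg, hpos, hcl, -, -, hdegrel⟩ :=
    ArithRlfPic.exists_pic_transport_deg hΦ₁ hΦ₂ ΨBase.asEquivalence Erlf
      (fun X => arith_realSpanCompat_of_datum Ψ ΨBase E η hdiv X)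
  refine ⟨deg, hpos, fun X D => ?_⟩
  -- `ι₁ D` and `ι₂ (Ψ^Φ D)`; `(Ψ^Φ)^rlf (ι₁ D) = ι₂ (Ψ^Φ D)`
  have hι : Erlf.iso X ((PreFrobenioid.IsPerfFactorialOn.op hΦ₁ (op X)).toRealification
        (Perfection.of _ (Multiplicative.ofAdd D))) =
      (PreFrobenioid.IsPerfFactorialOn.op hΦ₂ (op (ΨBase.obj X))).toRealification
        (Perfection.of _ (E.iso X (Multiplicative.ofAdd D))) :=
    FrdI.Cor54Sub.rlfIso_toRlf
      (ModelFrobenioid.toElem (arithDivisorFunctor F₁ K₁) (unitsFunctor F₁ K₁) (divNatTrans F₁ K₁)) hΦ₁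
      (ModelFrobenioid.toElem (arithDivisorFunctor F₂ K₂) (unitsFunctor F₂ K₂) (divNatTrans F₂ K₂)) hΦ₂ E X (Multiplicative.ofAdd D)
  have h1 := ArithRlfPic.picDegree_mk_iota hΦ₁ X D
  have h2 := ArithRlfPic.picDegree_mk_iota hΦ₂ (ΨBase.obj X) (Multiplicative.toAdd (E.iso X (Multiplicative.ofAdd D)))
  have h3 := hcl X ((PreFrobenioid.IsPerfFactorialOn.op hΦ₁ (op X)).toRealification
    (Perfection.of _ (Multiplicative.ofAdd D)))
  have h5 := hdegrel X (QuotientGroup.mk' _ (Algebra.GrothendieckGroup.of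
    ((PreFrobenioid.IsPerfFactorialOn.op hΦ₁ (op X)).toRealification (Perfection.of _ (Multiplicative.ofAdd D)))))
  have h5' : Multiplicative.toAdd (ArithRlfPic.picDegree hΦ₂ (ΨBase.obj X)
      (QuotientGroup.mk' _ (Algebra.GrothendieckGroup.of
        ((PreFrobenioid.IsPerfFactorialOn.op hΦ₂ (op (ΨBase.obj X))).toRealification
          (Perfection.of _ (E.iso X (Multiplicative.ofAdd D))))))) =
      deg * Multiplicative.toAdd (ArithRlfPic.picDegree hΦ₁ X
        (QuotientGroup.mk' _ (Algebra.GrothendieckGroup.of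
          ((PreFrobenioid.IsPerfFactorialOn.op hΦ₁ (op X)).toRealification
            (Perfection.of _ (Multiplicative.ofAdd D)))))) := by
    rw [← hι]
    exact h3 ▸ h5
  have h2' : ArithRlfPic.picDegree hΦ₂ (ΨBase.obj X)
      (QuotientGroup.mk' _ (Algebra.GrothendieckGroup.of
        ((PreFrobenioid.IsPerfFactorialOn.op hΦ₂ (op (ΨBase.obj X))).toRealification
          (Perfection.of _ (E.iso X (Multiplicative.ofAdd D)))))) =
      Multiplicative.ofAdd (arithDegree (ΨBase.obj X).L
        (EffArithDivisor.toArithDivisor _ (Multiplicative.toAdd (E.iso X (Multiplicative.ofAdd D))))) := h2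
  rw [h2', h1, toAdd_ofAdd, toAdd_ofAdd] at h5'
  exact h5'

/-! ### The binder `hθd` of Thm. 6.4 (iii): degrees along the perfected transport -/

omit [IsGalois F₁ K₁] [IsGalois F₂ K₂] [ΨBase.IsEquivalence] in
/-- **`hθd` — the degree relation along the PERFECTED transport `θ_L = (Ψ^Φ_L)^pf`** (the binder of
abc-iut-L1-d9's `thm64iii_of_mulEquiv`): if `deg^arith(Ψ^Φ_L D) = deg · deg^arith(D)` on `Φ₁(L)`, then for ANY
extensions `d_i : Φ_i(L_i)^pf → ℝ` of `deg^arith_{L_i}` (his `exists_arithDegree_extension`), `d₂ (θ_L x) = deg · d₁ x` —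
raise to the `n`-th power, `(a^{1/n})^n = a`. [cite: MochizukiFrdI2008, Thm. 6.4 (iii) p.115] -/
theorem perfectedTransport_degree_of_datum (deg : ℝ) (X : FinSubextCat F₁ K₁)
    (hdeg : ∀ D : EffArithDivisor X.L,
      arithDegree (ΨBase.obj X).L
          (EffArithDivisor.toArithDivisor _ (Multiplicative.toAdd (E.iso X (Multiplicative.ofAdd D)))) =
        deg * arithDegree X.L (EffArithDivisor.toArithDivisor _ D))
    (d₁ : Perfection (Multiplicative (EffArithDivisor X.L)) →* Multiplicative ℝ)
    (d₂ : Perfection (Multiplicative (EffArithDivisor (ΨBase.obj X).L)) →* Multiplicative ℝ)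
    (hd₁ : ∀ D, Multiplicative.toAdd (d₁ (Perfection.of _ (Multiplicative.ofAdd D))) =
      arithDegree X.L (EffArithDivisor.toArithDivisor _ D))
    (hd₂ : ∀ D, Multiplicative.toAdd (d₂ (Perfection.of _ (Multiplicative.ofAdd D))) =
      arithDegree (ΨBase.obj X).L (EffArithDivisor.toArithDivisor _ D))
    (x : Perfection (Multiplicative (EffArithDivisor X.L))) :
    Multiplicative.toAdd (d₂ (Perfection.congr (E.iso X) x)) = deg * Multiplicative.toAdd (d₁ x) := by
  obtain ⟨⟨a, n⟩, rfl⟩ := Perfection.mk_surjective x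
  show Multiplicative.toAdd (d₂ (Perfection.mk (E.iso X a) n)) = deg * Multiplicative.toAdd (d₁ (Perfection.mk a n))
  have hn : (n : ℝ) ≠ 0 := by exact_mod_cast n.ne_zero
  -- `n`-th powers: `(a^{1/n})^n = a` on both sides, where `d_i` read `deg^arith`
  have p₁ : (n : ℝ) * Multiplicative.toAdd (d₁ (Perfection.mk a n)) =
      arithDegree X.L (EffArithDivisor.toArithDivisor _ (Multiplicative.toAdd a)) := by
    have h := congrArg (fun y => Multiplicative.toAdd (d₁ y))
      (Perfection.mk_pow_self (M := Multiplicative (EffArithDivisor X.L)) a n)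
    rw [map_pow, toAdd_pow, nsmul_eq_mul] at h
    rw [h]
    exact hd₁ (Multiplicative.toAdd a)
  have p₂ : (n : ℝ) * Multiplicative.toAdd (d₂ (Perfection.mk (E.iso X a) n)) =
      arithDegree (ΨBase.obj X).L
        (EffArithDivisor.toArithDivisor _ (Multiplicative.toAdd (E.iso X a))) := by
    have h := congrArg (fun y => Multiplicative.toAdd (d₂ y))
      (Perfection.mk_pow_self (M := Multiplicative (EffArithDivisor (ΨBase.obj X).L)) (E.iso X a) n)
    rw [map_pow, toAdd_pow, nsmul_eq_mul] at h
    rw [h]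
    exact hd₂ (Multiplicative.toAdd (E.iso X a))
  have key : arithDegree (ΨBase.obj X).L
        (EffArithDivisor.toArithDivisor _ (Multiplicative.toAdd (E.iso X a))) =
      deg * arithDegree X.L (EffArithDivisor.toArithDivisor _ (Multiplicative.toAdd a)) :=
    hdeg (Multiplicative.toAdd a)
  have q : (n : ℝ) * Multiplicative.toAdd (d₂ (Perfection.mk (E.iso X a) n)) =
      (n : ℝ) * (deg * Multiplicative.toAdd (d₁ (Perfection.mk a n))) := by
    rw [p₂, key, mul_left_comm, p₁]
  exact mul_left_cancel₀ hn q

/-! ### The binder `hgen` of Thm. 6.4 (iv): log-norms along the place bijection -/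

omit [IsGalois F₁ K₁] [IsGalois F₂ K₂] [ΨBase.IsEquivalence] in
/-- **`hgen` — "`deg^arith_{L_i}` maps a generator of the monoid `Φ_i(L_i)_{v_i} (≅ ℤ_{≥0})` to `log N(v_i)`"** (Thm. 6.4
(iv) proof p. 116): along a bijection of finite places `π_L` with `Ψ^Φ_L(δ_w) = δ_{π_L w}` (generator ↦ generator) and
the degree clause of `Ψ^Φ`, `log N(π_L w) = deg · log N(w)` — the binder `hgen` of abc-iut-L1-t3's
`Thm64iv_of_logNorm_transport_schema` (with abc-iut-L1-d9's `EffArithDivisor.arithDegree_single_inr`).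
[cite: MochizukiFrdI2008, Thm. 6.4 (iv) p.116] -/
theorem logNorm_transport_of_datum (deg : ℝ) (X : FinSubextCat F₁ K₁)
    (hdeg : ∀ D : EffArithDivisor X.L,
      arithDegree (ΨBase.obj X).L
          (EffArithDivisor.toArithDivisor _ (Multiplicative.toAdd (E.iso X (Multiplicative.ofAdd D)))) =
        deg * arithDegree X.L (EffArithDivisor.toArithDivisor _ D))
    (π : FinitePlace X.L ≃ FinitePlace (ΨBase.obj X).L)
    (hπ : ∀ w : FinitePlace X.L,
      E.iso X (Multiplicative.ofAdd (EffArithDivisor.single X.L (Sum.inr w))) =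
        Multiplicative.ofAdd (EffArithDivisor.single (ΨBase.obj X).L (Sum.inr (π w))))
    (w : FinitePlace X.L) : logNorm (π w) = deg * logNorm w := by
  have key := hdeg (EffArithDivisor.single X.L (Sum.inr w))
  rw [hπ w, toAdd_ofAdd, EffArithDivisor.single_inr, EffArithDivisor.single_inr,
    EffArithDivisor.arithDegree_single_inr, EffArithDivisor.arithDegree_single_inr] at key
  simpa using key

include η hdiv in
/-- **The adapter, packaged for the assembly of Thm. 6.4 (iii)/(iv) at the data**: for the Cor. 4.11 (iv) datum of
`Ψ : C_{K₁/F₁} ⥲ C_{K₂/F₂}` and place bijections `π_L` along which `Ψ^Φ` maps generators to generators, ONE `deg > 0`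
gives at once the degree clause of `Ψ^Φ`, the relation `hθd` for the perfected transports `θ_L = (Ψ^Φ_L)^pf` with any
degree extensions, and `log N(π_L w) = deg · log N(w)` at every finite place.
[cite: MochizukiFrdI2008, Thm. 6.4 (iii) p.115] -/
theorem exists_deg_adapter_of_datum
    (π : ∀ X : FinSubextCat F₁ K₁, FinitePlace X.L ≃ FinitePlace (ΨBase.obj X).L)
    (hπ : ∀ (X : FinSubextCat F₁ K₁) (w : FinitePlace X.L),
      E.iso X (Multiplicative.ofAdd (EffArithDivisor.single X.L (Sum.inr w))) =
        Multiplicative.ofAdd (EffArithDivisor.single (ΨBase.obj X).L (Sum.inr (π X w)))) :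
    ∃ deg : ℝ, 0 < deg ∧
      (∀ (X : FinSubextCat F₁ K₁) (D : EffArithDivisor X.L),
        arithDegree (ΨBase.obj X).L
            (EffArithDivisor.toArithDivisor _ (Multiplicative.toAdd (E.iso X (Multiplicative.ofAdd D)))) =
          deg * arithDegree X.L (EffArithDivisor.toArithDivisor _ D)) ∧
      (∀ (X : FinSubextCat F₁ K₁)
        (d₁ : Perfection (Multiplicative (EffArithDivisor X.L)) →* Multiplicative ℝ)
        (d₂ : Perfection (Multiplicative (EffArithDivisor (ΨBase.obj X).L)) →* Multiplicative ℝ),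
        (∀ D, Multiplicative.toAdd (d₁ (Perfection.of _ (Multiplicative.ofAdd D))) =
          arithDegree X.L (EffArithDivisor.toArithDivisor _ D)) →
        (∀ D, Multiplicative.toAdd (d₂ (Perfection.of _ (Multiplicative.ofAdd D))) =
          arithDegree (ΨBase.obj X).L (EffArithDivisor.toArithDivisor _ D)) →
        ∀ x, Multiplicative.toAdd (d₂ (Perfection.congr (E.iso X) x)) = deg * Multiplicative.toAdd (d₁ x)) ∧
      ∀ (X : FinSubextCat F₁ K₁) (w : FinitePlace X.L), logNorm (π X w) = deg * logNorm w := by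
  obtain ⟨deg, hpos, hdeg⟩ := exists_deg_divisorTransport_of_datum Ψ ΨBase E η hdiv
  exact ⟨deg, hpos, hdeg,
    fun X d₁ d₂ hd₁ hd₂ x => perfectedTransport_degree_of_datum ΨBase E deg X (hdeg X) d₁ d₂ hd₁ hd₂ x,
    fun X w => logNorm_transport_of_datum ΨBase E deg X (hdeg X) (π X) (hπ X) w⟩

end Arith

end Literature.AlgebraicGeometry.Frobenioids

end
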